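import Literature.NumberTheory.LFunctions.KMVCompletedLHalfIntegral
import Literature.NumberTheory.LFunctions.KMVCentralValueSquaredAFEHead
import Literature.NumberTheory.LFunctions.KMVCentralValueSquaredAFESeries
import Literature.NumberTheory.EllipticCurves.CuspFormFrickeAxisIntegral
import Literature.NumberTheory.EllipticCurves.PAdicLFunctionNonvanishingProofs
import Literature.NumberTheory.EllipticCurves.CuspFormLFunctionNewformFrickeProofs
import HarnessLib

/-!
# KMV 2000 (21)–(22) at `k = 0` — PROOF: `KMV2000.completedL_half_sq_eq_holds`
# `Λ(f,½)² = 2q̂ Σ_{n₁,n₂≥1} λ_f(n₁)λ_f(n₂)(n₁n₂)^{−1/2} W(n₁n₂/q̂²)` (discharge of the named statement)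

Source: E. Kowalski, P. Michel, J. VanderKam, *Non-vanishing of high derivatives of automorphic
`L`-functions at the center of the critical strip*, J. reine angew. Math. 526 (2000) 1–34, §5 p. 12,
(21)–(22) [held: paper:doi-10-1515-crll-2000-074]: «The functional equation for `Λ(f, 1/2 + s)` has
always sign `+1` so manipulations similar as those performed in the previous section yield (…)».
Cell landau-siegel / ls-inputs, H-AFE (K-INPUTS-7 (3)); fact skeleton `fricke-real-split` (crux
workfile `Cruxes/BeyondDiagonalBeatsQuarter/Lines/fricke_real_split.lean` on stmt-Parity-20343),
seats ls-inputs-Hafe-lead g0 (S1, S2, S4, assembly) and ls-inputs-Hafe-w1 g0 (S3).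

## The proof (real-variable; no contour shift, no Stirling, no Bessel functions)

Let `f ∈ S₂(Γ₀(N))` with `w_N f = ε f`, `ε² = 1` (every newform: Atkin–Lehner), `F(y) = f(iy)`,
`A = ∫_0^∞ F`, `H(y) = ∫_0^y F`, `T(y) = ∫_{v > 1/(Ny)} F`.
* S1 `KMV2000.completedL_half_eq_integral`: `Λ(f,½) = 2π q̂^{1/2} A`.
* S4 `KMV2000.hasSum_afeSqTerm`: `Σ_{ℕ×ℕ} afeSqTerm = 4π² ∫_0^∞ F·T` (absolutely).
* S2 `IsFrickeEigen.integral_imagAxis_Ioi_inv_mul`: `T(y) = −ε H(y)` (`f(i/(Nv)) = −εNv² f(iv)`).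
* S3 `KMV2000.integral_imagAxis_mul_head`: `∫_0^∞ F·H = A²/2`.
* `A = −εA` (the tree's symmetric split `IsFrickeEigen.integral_imagAxis_Ioc_eq` at `1/√N` + `ε² = 1`).
Hence `2q̂ Σ = 2q̂·4π²·(−εA²/2) = −4π²q̂ εA² = 4π² q̂ A² = Λ(f,½)²`: sign `+1`, no `ε` survives.

## Results

* `KMV2000.integral_imagAxis_eq_neg_eps_mul` — `A = −εA`.
* `KMV2000.completedL_half_sq_eq_of_fricke` — the identity (with absolute convergence) at EVERY
  level `N ≥ 1` for every `f ∈ S₂(Γ₀(N))` with `w_N f = εf`, `ε² = 1`.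
* `KMV2000.completedL_half_sq_eq_of_mem_newforms0` — for newforms of any level.
* `KMV2000.completedL_half_sq_eq_holds : completedL_half_sq_eq` — the printed fact (prime level).
No named fact is used: the statement `completedL_half_sq_eq` (p624193) is now a kernel theorem.
-/

noncomputable section

open scoped Real
open Complex Set MeasureTheory CongruenceSubgroup UpperHalfPlane
open Literature.NumberTheory.EllipticCurves.ModularForms

namespace Literature.NumberTheory.LFunctions.KMV2000

variable {N : ℕ} [NeZero N]

/-- **`A = −ε A`** for `A = ∫_0^∞ f(iy) dy` when `f(-1/(Nτ)) = εNτ²f(τ)` and `ε² = 1`: split `A` at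
`1/√N` and flip the lower piece (`IsFrickeEigen.integral_imagAxis_Ioc_eq`: `∫_0^{1/√N} F = −ε ∫_{1/√N}^∞ F`),
so `A = (1−ε)X` and `−εA = (ε²−ε)X = (1−ε)X`. (Equivalently `Λ(f,½) = −ε_Fricke Λ(f,½)`, KMV p. 2.)
[cite: KowalskiMichelVanderKam2000, §1 p. 2 (functional equation, sign ε_f)] -/
theorem integral_imagAxis_eq_neg_eps_mul (f : CuspForm (Gamma0 N) 2) {ε : ℂ}
    (hW : IsFrickeEigen N f ε) (hε : ε ^ 2 = 1) :
    ∫ y in Ioi (0 : ℝ), f (UpperHalfPlane.ofComplex (Complex.I * y)) =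
      -ε * ∫ y in Ioi (0 : ℝ), f (UpperHalfPlane.ofComplex (Complex.I * y)) := by
  set g : ℝ → ℂ := fun t ↦ f (UpperHalfPlane.ofComplex (Complex.I * t)) with hg_def
  set b : ℝ := (Real.sqrt N)⁻¹ with hb_def
  have hb : 0 < b := inv_pos.mpr (Real.sqrt_pos.mpr (by exact_mod_cast NeZero.pos N))
  have hg : IntegrableOn g (Ioi 0) := integrableOn_imagAxis f
  have hsplit : ∫ t in Ioi (0 : ℝ), g t = (∫ t in Ioc 0 b, g t) + ∫ t in Ioi b, g t := by
    have h := intervalIntegral.integral_Ioi_sub_Ioi hg hb.le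
    rw [intervalIntegral.integral_of_le hb.le] at h
    linear_combination h
  have hflip : ∫ t in Ioc (0 : ℝ) b, g t = -ε * ∫ t in Ioi b, g t := hW.integral_imagAxis_Ioc_eq
  rw [hsplit, hflip]
  linear_combination (-(∫ t in Ioi b, g t)) * hε

/-- **KMV (21)–(22) at `k = 0` for every Fricke eigen-cusp-form, every level**: if
`f ∈ S₂(Γ₀(N))`, `w_N f = ε f` and `ε² = 1`, then the double series `Σ afeSqTerm N f` converges
absolutely and `Λ(f,½)² = 2 q̂ Σ'_{ℕ×ℕ} λ_f(n₁)λ_f(n₂)(n₁n₂)^{−1/2} W(n₁n₂/q̂²)`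
(`q̂ = √N/2π`, `Λ = KMV2000.completedL N f`). [cite: KowalskiMichelVanderKam2000, (21)–(22) p. 12] -/
theorem completedL_half_sq_eq_of_fricke (f : CuspForm (Gamma0 N) 2) {ε : ℂ}
    (hfr : frickeInvolution N 2 f = ε • f) (hε : ε ^ 2 = 1) :
    Summable (afeSqTerm N f) ∧
      completedL N f (1 / 2) ^ 2 = 2 * (qhat N : ℂ) * ∑' n : ℕ × ℕ, afeSqTerm N f n := by
  have hW : IsFrickeEigen N f ε := isFrickeEigen_of_frickeInvolution_eq_smul N hfr
  have h4 := hasSum_afeSqTerm f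
  refine ⟨h4.summable, ?_⟩
  -- the inner tail integral is `-ε ∫_{Ioc 0 y} F` on `Ioi 0` (S2)
  have hT : ∫ y in Ioi (0 : ℝ), f (UpperHalfPlane.ofComplex (Complex.I * y)) *
        ∫ v in Ioi (((N : ℝ) * y)⁻¹), f (UpperHalfPlane.ofComplex (Complex.I * v)) =
      -ε * ∫ y in Ioi (0 : ℝ), f (UpperHalfPlane.ofComplex (Complex.I * y)) *
        ∫ u in Ioc (0 : ℝ) y, f (UpperHalfPlane.ofComplex (Complex.I * u)) := by
    rw [← integral_const_mul]
    refine setIntegral_congr_fun measurableSet_Ioi fun y hy ↦ ?_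
    rw [hW.integral_imagAxis_Ioi_inv_mul hy]
    ring
  have hA0 := integral_imagAxis_eq_neg_eps_mul f hW hε
  have hsq : (((qhat N : ℝ) : ℂ) ^ (1 / 2 : ℂ)) ^ 2 = (qhat N : ℂ) := by
    rw [← cpow_nat_mul]
    norm_num
  rw [h4.tsum_eq, completedL_half_eq_integral f, hT, integral_imagAxis_mul_head f]
  set A : ℂ := ∫ y in Ioi (0 : ℝ), f (UpperHalfPlane.ofComplex (Complex.I * y)) with hA_def
  have hA' : ε * A = -A := by linear_combination ε * hA0 - A * hε
  rw [mul_pow, mul_pow, hsq]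
  linear_combination (4 : ℂ) * (π : ℂ) ^ 2 * (qhat N : ℂ) * A * hA'

/-- **KMV (21)–(22) at `k = 0` for newforms of any level** `N ≥ 1` (`w_N f = ε_f f`, `ε_f = ±1` by
Atkin–Lehner: `IsNewform0.frickeInvolution_eq_smul_holds`, `…frickeEigenvalue_eq_one_or_eq_neg_one_holds`).
[cite: KowalskiMichelVanderKam2000, (21)–(22) p. 12] -/
theorem completedL_half_sq_eq_of_mem_newforms0 (f : CuspForm (Gamma0 N) 2) (hf : f ∈ newforms0 N 2) :
    Summable (afeSqTerm N f) ∧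
      completedL N f (1 / 2) ^ 2 = 2 * (qhat N : ℂ) * ∑' n : ℕ × ℕ, afeSqTerm N f n := by
  have hfr : frickeInvolution N 2 f = frickeEigenvalue f • f :=
    IsNewform0.frickeInvolution_eq_smul_holds hf
  have hε : frickeEigenvalue f ^ 2 = 1 := by
    rcases IsNewform0.frickeEigenvalue_eq_one_or_eq_neg_one_holds (N := N) (k := (2 : ℤ)) hf with
      h | h <;> rw [h] <;> norm_num
  exact completedL_half_sq_eq_of_fricke f hfr hε

/-- **Discharge of the named statement `KMV2000.completedL_half_sq_eq`** (KMV 2000 (21)–(22) at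
`k = 0`, `q` prime, `f ∈ S₂(q)^*`): a kernel theorem — the fact is no longer an input.
[cite: KowalskiMichelVanderKam2000, (21)–(22) p. 12] -/
theorem completedL_half_sq_eq_holds : completedL_half_sq_eq :=
  fun q _ _ f hf ↦ completedL_half_sq_eq_of_mem_newforms0 (N := q) f hf

end Literature.NumberTheory.LFunctions.KMV2000

end
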